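import Summits.ABC.IUTFork.LDHSlotResiduePointPair
import Literature.IUT.LogVolume.PilotSlotResidueBounds
import Literature.IUT.LogVolume.PilotSlotResidueSupport
import Mathlib.Algebra.BigOperators.Ring.Finset
import Mathlib.Tactic.Positivity
import Mathlib.Tactic.FieldSimp
import HarnessLib

/-!
# The fork at [IUTchIII] Corollary 3.12, L-DH level: the GOOD-SHARE lower bound for the (Ind1) slot residue —
# at a support prime, the residue is at least the good-place mass times the FULL `p`-part of `deĝ̲_lgp(P_Θ)`

Record-only PROOF file (D-0012) of the abc-iut cell (block C / W6 seat abc-iut-w6-d018, gen 2; sequel to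
abc-iut-S8's `Literature/IUT/LogVolume/PilotSlotResidueBounds.lean` + `Summits/ABC/IUTFork/LDHSlotResidue.lean` and
abc-iut-S7's `LDHSlotResiduePointPair.lean`); TAKES NO SIDE on [IUTchIII] Cor. 3.12 or [IUTchIV] Thm. 1.10.
Sources: Dupuy–Hilado, arXiv:2004.13228 [DupuyHilado2025] §3.3 (`P_{Θ,j} = j²·P_q`), §3.6 (weights
`Pr(v) = n_v/[F:ℚ]`, `Σ_{v|p} Pr(v) = 1`, product weights on collections `v⃗ ∈ V(F)_p^{j+1}`), §4.7 ((Ind1) =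
permutations of the tensor factors), §4.11–4.12 (`U_Θ`, hull); S. Mochizuki, *IUT IV* [Mochizuki2012], proof of
Thm. 1.10 Step (v) p. 27–28 ("`i†` to be `j`"; "after symmetrizing with respect to the choice of "`i† ∈ I`" … does
not affect the computation of the upper bound"); the cell's audit note HOME/plan/c312/STEPV-IND1-NOTE.md §4
(regime (b): "a w-fraction ω of the places over `p` has `μ = 0`").

WHAT IS PROVED (pure finite-sum combinatorics over the typed `PilotData`, then composition with S8/S7 BY NAME).
For pilot data `X` over `F`, a prime `p`, and any set `G ⊆ V(F)_p` of places on which every slot value `θ_j`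
vanishes (e.g. the places over `p` OUTSIDE the bad set `X.S`, `slotValue_eq_zero_of_not_mem`), with
`ω_G := Σ_{v∈G} Pr(v)`:
* `ndegLgpOn_singleton_eq` / `ndegLgpOn_singleton_closed` — the `p`-part of the last-slot aggregate is
  `ndegLgpOn X {p} = (1/ℓ⋇)Σ_j Σ_{v|p} θ_j(v)·Pr(v) = ((ℓ⋇+1)(2ℓ⋇+1)/6)·Σ_{v|p} μ(v)·Pr(v)`, `μ(v) = P_q(v)·ln|κ(v)|/n_v`
  (independence of the slots: the other `j` slots integrate to `1`);
* `mul_sum_slotValue_le_inner_defect_sum` — per procession index: `ω_G·Σ_{v|p} θ_j(v)Pr(v) ≤ Σ_{v⃗}(θ_j(v⃗(j)) −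
  min_k θ_j(v⃗(k)))·Π_k Pr(v⃗(k))`: keep the collections whose slot `0` lies in `G` — there the minimum is `0`, so the
  defect is the full last-slot value; their weight is `ω_G` times the last-slot marginal (two-slot independence);
* `mul_ndegLgpOn_singleton_le_slotResidue` — **`ω_G · ndegLgpOn X {p} ≤ slotResidue X T`** for `p ∈ T`;
* `goodWeight_mul_ndegLgpOn_le_slotResidue` / `goodWeight_mul_closed_le_slotResidue` — with `G` = the places over `p`
  outside `X.S`: **`(1 − β_p)·((ℓ⋇+1)(2ℓ⋇+1)/6)·Σ_{v|p} μ(v)Pr(v) ≤ slotResidue X T`**, `β_p = Σ_{v|p, v∈S} Pr(v)` the bad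
  mass of abc-iut-c312-3's `GenuineLogThetaSplitBadPrimes` (`goodWeight_eq_one_sub_badWeight`).
So at a prime where a fraction `1 − β_p > 0` of `[F:ℚ]` is carried by good places, the (Ind1) slot residue retains
AT LEAST that fraction of the WHOLE `p`-part of `deĝ̲_lgp(P_Θ)` — the full-mass complement of S8's one-pair bound
`slotResidue_ge_pair_closed` (factor `Pr(v)·Pr(v')`, one pair of places).
Compositions (S8 `slotResidue_le_of_hullEstimateOf`, `slotResidue_le_of_hullVolumeAtDatum`; S7 `avgSq_eq`):
* `DHData.goodWeight_mul_le_of_hullEstimateOf` — every hull-volume estimate `δ` of a genuine Θ-volume input satisfies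
  `(1 − β_p)·((ℓ⋇+1)(2ℓ⋇+1)/6)·Σ_{v|p} μ(v)Pr(v) ≤ δ` at every support prime `p`;
* `PointDict.goodWeight_mul_le_of_hullVolumeAtDatum` — at the `λ`-line: `Cor22.HullVolumeAtDatum P l δ` (the conclusion
  of the `hvol` binder of `Conditional/AbcOfS*.lean`, there with the printed `B(P,l)`) forces, for EVERY genuine datum
  `T` at `(P,l)` and every support prime `p`, `(1 − β_p(T))·(l(l+1)/12)·Σ_{v|p} μ_T(v)Pr(v) ≤ δ` — i.e. the good-share of
  the `p`-part of `((l+1)/24)·log(q)` is bounded by `δ`: a condition on the POINT's `q`-orders at mixed primes of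
  `F_mod`, vacuous iff every support prime is totally bad or totally good over `F_mod` (in particular at `d_mod = 1`).
READING (for §K / VERDICT ¶7 and the R2 S-chain TARGET #1; nothing asserted): together with abc-iut-c312-d1's
`LDHGenuineStepVResidue.hullEstimateOf_ofInput_stepV_add_slotResidue` (the residue ADDED is sufficient) this is the
lower half of the two-sided statement «on the UNION line, (ii′-U) at `d_mod ≥ 2` restricts the mixed-prime `q`-mass of
the point»; no datum is constructed here; the line of record (P) does not carry `hvol`.
[cite: DupuyHilado2025, §3.3, §3.6, §4.7, §4.11, §4.12] [cite: Mochizuki2012, IUTchIV Thm. 1.10 Step (v) p. 27–28]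
[claim: Mochizuki2012, status: disputed] for every IUT quotation. No side taken on [IUTchIII] Cor. 3.12.
-/

noncomputable section

namespace Literature.IUT.LogVolume

open NumberField IsDedekindDomain Finset

namespace PilotData

variable {F : Type*} [Field F] [NumberField F] (X : PilotData F)

/-- Independence of the slots (two-coordinate marginal of the product weights): for weights `w` with
`Σ_s w(s) = 1` and distinct slots `a ≠ b`, `Σ_{e} f(e(a))·g(e(b))·Π_k w(e(k)) = (Σ_s f(s)w(s))·(Σ_s g(s)w(s))`.
[folklore] -/
-- adapted from abc-iut-S8's private `PilotSlotResidueBounds.sum_mul_mul_prod_eq` (same statement and proof)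
private theorem sum_mul_mul_prod_eq₂ {S : Type*} [Fintype S] [DecidableEq S] (w : S → ℝ)
    (hw : ∑ s, w s = 1) {m : ℕ} (a b : Fin (m + 1)) (hab : a ≠ b) (f g : S → ℝ) :
    ∑ e : Fin (m + 1) → S, f (e a) * g (e b) * ∏ k, w (e k) =
      (∑ s, f s * w s) * (∑ s, g s * w s) := by
  have key : ∀ e : Fin (m + 1) → S, f (e a) * g (e b) * ∏ k, w (e k) =
      ∏ k, (w (e k) * (if k = a then f (e k) else 1) * (if k = b then g (e k) else 1)) := by
    intro e
    rw [Finset.prod_mul_distrib, Finset.prod_mul_distrib, Fintype.prod_ite_eq', Fintype.prod_ite_eq']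
    ring
  rw [Finset.sum_congr rfl (fun e _ => key e)]
  have hswap : ∑ e : Fin (m + 1) → S,
      ∏ k, (w (e k) * (if k = a then f (e k) else 1) * (if k = b then g (e k) else 1)) =
      ∏ k : Fin (m + 1), ∑ s : S, (w s * (if k = a then f s else 1) * (if k = b then g s else 1)) := by
    rw [Finset.prod_univ_sum, Fintype.piFinset_univ]
  rw [hswap]
  have hk : ∀ k : Fin (m + 1), ∑ s : S, (w s * (if k = a then f s else 1) * (if k = b then g s else 1)) =
      (if k = a then ∑ s, f s * w s else 1) * (if k = b then ∑ s, g s * w s else 1) := by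
    intro k
    by_cases hka : k = a
    · subst hka
      simp only [if_true, if_neg hab, mul_one]
      exact Finset.sum_congr rfl fun s _ => by ring
    · by_cases hkb : k = b
      · subst hkb
        simp only [hka, if_false, if_true, mul_one, one_mul]
        exact Finset.sum_congr rfl fun s _ => by ring
      · simp only [hka, hkb, if_false, mul_one]
        exact hw
  rw [Finset.prod_congr rfl (fun k _ => hk k), Finset.prod_mul_distrib, Fintype.prod_ite_eq',
    Fintype.prod_ite_eq']

/-- Slot `0` and the last slot of a collection of length `j+1 ≥ 2` are distinct. [folklore] -/
private theorem zero_ne_last (i : ℕ) : (0 : Fin (i + 1 + 1)) ≠ Fin.last _ := by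
  intro h
  have := congrArg Fin.val h
  simp at this

/-- **The `p`-part of the last-slot aggregate, marginalised**: `ndegLgpOn X {p} = (1/ℓ⋇)·Σ_j Σ_{v|p} θ_j(v)·Pr(v)`
(the `j` non-distinguished slots of each collection integrate to `Σ_{v|p} Pr(v) = 1`).
[cite: DupuyHilado2025, §3.6] -/
theorem ndegLgpOn_singleton_eq (p : ℕ) [Fact p.Prime] :
    X.ndegLgpOn {p} = (1 / (X.lstar : ℝ)) * ∑ i : Fin X.lstar,
      ∑ v : placesOver F p, X.slotValue i v.1 * weight F v.1 := by
  classical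
  unfold ndegLgpOn
  rw [Finset.sum_singleton]
  congr 1
  refine Finset.sum_congr rfl fun i _ => ?_
  have h := sum_mul_mul_prod_eq₂ (fun u : placesOver F p => weight F u.1) (sum_weight_placesOver p)
    0 (Fin.last _) (zero_ne_last i) (fun _ => (1 : ℝ)) (fun u => X.slotValue i u.1)
  simp only [one_mul] at h
  rw [h, sum_weight_placesOver (F := F) p, one_mul]

/-- **Closed form of the `p`-part**: `ndegLgpOn X {p} = ((ℓ⋇+1)(2ℓ⋇+1)/6)·Σ_{v|p} μ(v)·Pr(v)` with
`μ(v) = P_q(v)·ln|κ(v)|/n_v` (`θ_j = j²·μ`, `(1/ℓ⋇)Σ_j j² = (ℓ⋇+1)(2ℓ⋇+1)/6`) — the `p`-summand of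
`deĝ̲_lgp(P_Θ) = ((l+1)/24)·(2l)·deĝ̲(P_q)`. [cite: DupuyHilado2025, §3.3, §3.6] -/
theorem ndegLgpOn_singleton_closed (p : ℕ) [Fact p.Prime] :
    X.ndegLgpOn {p} = (((X.lstar : ℝ) + 1) * (2 * X.lstar + 1) / 6) *
      ∑ v : placesOver F p, (X.qPilot v.1 * logNorm F v.1 / (localDegree F v.1 : ℝ)) * weight F v.1 := by
  rw [ndegLgpOn_singleton_eq]
  have hi : ∀ i : Fin X.lstar, ∑ v : placesOver F p, X.slotValue i v.1 * weight F v.1 =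
      (((i : ℕ) + 1 : ℝ) ^ 2) *
        ∑ v : placesOver F p, (X.qPilot v.1 * logNorm F v.1 / (localDegree F v.1 : ℝ)) * weight F v.1 := by
    intro i
    rw [Finset.mul_sum]
    refine Finset.sum_congr rfl fun v _ => ?_
    rw [slotValue_eq_sq_mul]
    ring
  rw [Finset.sum_congr rfl (fun i _ => hi i), ← Finset.sum_mul, ← mul_assoc, procAvg_sq]

/-- **Per procession index, the good-share bound**: for a prime `p`, degree `j = i+1` and a set `G` of places over
`p` with `θ_j ≡ 0` on `G`, `(Σ_{v∈G} Pr(v))·Σ_{v|p} θ_j(v)Pr(v) ≤ Σ_{v⃗∈V(F)_p^{j+1}} (θ_j(v⃗(j)) − min_k θ_j(v⃗(k)))·Π_k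
Pr(v⃗(k))`: on the collections with `v⃗(0) ∈ G` the minimum is `≤ θ_j(v⃗(0)) = 0`, so the defect is `≥ θ_j(v⃗(j))`; their
total contribution is `ω_G` times the last-slot marginal (two-slot independence); all other terms are `≥ 0`.
[cite: DupuyHilado2025, §4.7] -/
theorem mul_sum_slotValue_le_inner_defect_sum (p : ℕ) [Fact p.Prime] (i : Fin X.lstar)
    (G : Finset (placesOver F p)) (hG : ∀ v ∈ G, X.slotValue i v.1 = 0) :
    (∑ v ∈ G, weight F v.1) * (∑ v : placesOver F p, X.slotValue i v.1 * weight F v.1) ≤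
      ∑ e : Fin ((i : ℕ) + 1 + 1) → placesOver F p,
        (X.slotValue i (e (Fin.last _)).1
          - Finset.univ.inf' Finset.univ_nonempty (fun k => X.slotValue i (e k).1)) *
          ∏ k, weight F (e k).1 := by
  classical
  have hG' : ∑ v ∈ G, weight F v.1 =
      ∑ v : placesOver F p, (if v ∈ G then (1 : ℝ) else 0) * weight F v.1 := by
    simp only [boole_mul]
    rw [← Finset.sum_filter]
    congr 1
    ext v
    simp
  calc (∑ v ∈ G, weight F v.1) * (∑ v : placesOver F p, X.slotValue i v.1 * weight F v.1)
      = ∑ e : Fin ((i : ℕ) + 1 + 1) → placesOver F p,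
          (if e 0 ∈ G then (1 : ℝ) else 0) * X.slotValue i (e (Fin.last _)).1 * ∏ k, weight F (e k).1 := by
        rw [hG']
        exact (sum_mul_mul_prod_eq₂ (fun u : placesOver F p => weight F u.1) (sum_weight_placesOver p)
          0 (Fin.last _) (zero_ne_last i) (fun u => if u ∈ G then (1 : ℝ) else 0)
          (fun u => X.slotValue i u.1)).symm
    _ ≤ _ := by
        refine Finset.sum_le_sum fun e _ => ?_
        have hw : 0 ≤ ∏ k, weight F (e k).1 := prod_weight_nonneg e
        have hlast : Finset.univ.inf' Finset.univ_nonempty (fun k => X.slotValue i (e k).1) ≤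
            X.slotValue i (e (Fin.last _)).1 := Finset.inf'_le _ (Finset.mem_univ _)
        by_cases h0 : e 0 ∈ G
        · rw [if_pos h0, one_mul]
          refine mul_le_mul_of_nonneg_right ?_ hw
          have hmin : Finset.univ.inf' Finset.univ_nonempty (fun k => X.slotValue i (e k).1) ≤
              X.slotValue i (e 0).1 := Finset.inf'_le _ (Finset.mem_univ _)
          rw [hG _ h0] at hmin
          linarith
        · rw [if_neg h0, zero_mul, zero_mul]
          exact mul_nonneg (sub_nonneg.mpr hlast) hw

/-- **The good-share bound at one prime**: for a prime `p` and a set `G` of places over `p` on which EVERY slot value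
vanishes, `(Σ_{v∈G} Pr(v))·ndegLgpOn X {p} ≤ slotResidue X {p}`. [cite: DupuyHilado2025, §4.7, §4.11, §4.12] -/
theorem mul_ndegLgpOn_singleton_le_slotResidue_singleton (p : ℕ) [Fact p.Prime]
    (G : Finset (placesOver F p)) (hG : ∀ v ∈ G, ∀ i : Fin X.lstar, X.slotValue i v.1 = 0) :
    (∑ v ∈ G, weight F v.1) * X.ndegLgpOn {p} ≤ X.slotResidue {p} := by
  have hl : (0 : ℝ) ≤ 1 / (X.lstar : ℝ) := by positivity
  rw [ndegLgpOn_singleton_eq, mul_left_comm, Finset.mul_sum, slotResidue_eq_sum, Finset.sum_singleton]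
  refine mul_le_mul_of_nonneg_left (Finset.sum_le_sum fun i _ => ?_) hl
  exact X.mul_sum_slotValue_le_inner_defect_sum p i G fun v hv => hG v hv i

/-- **The good-share lower bound for the (Ind1) slot residue**: for a prime `p ∈ T` and a set `G` of places over `p`
on which every slot value vanishes, `(Σ_{v∈G} Pr(v))·ndegLgpOn X {p} ≤ slotResidue X T` — the residue keeps at least
the `G`-mass of the WHOLE `p`-part of the last-slot aggregate `deĝ̲_lgp(P_Θ)`.
[cite: DupuyHilado2025, §4.7, §4.11, §4.12] -/
theorem mul_ndegLgpOn_singleton_le_slotResidue (T : Finset ℕ) {p : ℕ} [Fact p.Prime] (hp : p ∈ T)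
    (G : Finset (placesOver F p)) (hG : ∀ v ∈ G, ∀ i : Fin X.lstar, X.slotValue i v.1 = 0) :
    (∑ v ∈ G, weight F v.1) * X.ndegLgpOn {p} ≤ X.slotResidue T :=
  (X.mul_ndegLgpOn_singleton_le_slotResidue_singleton p G hG).trans
    (X.slotResidue_mono (Finset.singleton_subset_iff.mpr hp))

open scoped Classical in
/-- **Good places see no theta value**, so the good-share bound applies with `G :=` the places over `p` outside the
bad set `X.S`: `(Σ_{v|p, v∉S} Pr(v))·ndegLgpOn X {p} ≤ slotResidue X T` for `p ∈ T`.
[cite: DupuyHilado2025, §3.3, §4.7] -/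
theorem goodWeight_mul_ndegLgpOn_le_slotResidue (T : Finset ℕ) {p : ℕ} [Fact p.Prime] (hp : p ∈ T) :
    (∑ v ∈ Finset.univ.filter (fun v : placesOver F p => v.1 ∉ X.S), weight F v.1) * X.ndegLgpOn {p} ≤
      X.slotResidue T :=
  X.mul_ndegLgpOn_singleton_le_slotResidue T hp _ fun _ hv i =>
    X.slotValue_eq_zero_of_not_mem i (Finset.mem_filter.mp hv).2

open scoped Classical in
/-- **Closed form — STEPV-IND1-NOTE §4 regime (b) in the kernel**: for a prime `p ∈ T`,
`(Σ_{v|p, v∉S} Pr(v)) · ((ℓ⋇+1)(2ℓ⋇+1)/6) · Σ_{v|p} μ(v)Pr(v) ≤ slotResidue X T`, `μ(v) = P_q(v)·ln|κ(v)|/n_v`: at a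
prime where the good places carry the fraction `1 − β_p` of `[F:ℚ]`, the (Ind1) slot residue is at least `1 − β_p`
times the full `p`-part of `deĝ̲_lgp(P_Θ)`. [cite: Mochizuki2012, IUTchIV Thm. 1.10 Step (v) p. 27–28] -/
theorem goodWeight_mul_closed_le_slotResidue (T : Finset ℕ) {p : ℕ} [Fact p.Prime] (hp : p ∈ T) :
    (∑ v ∈ Finset.univ.filter (fun v : placesOver F p => v.1 ∉ X.S), weight F v.1) *
        ((((X.lstar : ℝ) + 1) * (2 * X.lstar + 1) / 6) *
          ∑ v : placesOver F p, (X.qPilot v.1 * logNorm F v.1 / (localDegree F v.1 : ℝ)) * weight F v.1) ≤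
      X.slotResidue T := by
  rw [← ndegLgpOn_singleton_closed]
  exact X.goodWeight_mul_ndegLgpOn_le_slotResidue T hp

open scoped Classical in
/-- The good mass over `p` is `1 −` the bad mass `β_p = Σ_{v|p, v∈S} Pr(v)` of abc-iut-c312-3's
`GenuineLogThetaSplitBadPrimes` (`Σ_{v|p} Pr(v) = 1`). [cite: DupuyHilado2025, §3.6] -/
theorem goodWeight_eq_one_sub_badWeight (p : ℕ) [Fact p.Prime] :
    ∑ v ∈ Finset.univ.filter (fun v : placesOver F p => v.1 ∉ X.S), weight F v.1 =
      1 - ∑ v ∈ Finset.univ.filter (fun v : placesOver F p => v.1 ∈ X.S), weight F v.1 := by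
  rw [eq_sub_iff_add_eq, add_comm, Finset.sum_filter_add_sum_filter_not, sum_weight_placesOver (F := F) p]

end PilotData

end Literature.IUT.LogVolume

/-! ## Compositions with abc-iut-S8 / S7 BY NAME: genuine inputs and the `λ`-line -/

namespace Summit.ABC.IUTFork

open Literature.IUT.HodgeTheaters Literature.IUT.LogVolume NumberField IsDedekindDomain
open Literature.NumberTheory.DiophantineGeometry.GenEll
open scoped Classical

namespace DHData

section Input

variable {F₀ : Type} [Field F₀] [NumberField F₀] {K : Type} [Field K] [NumberField K] [Algebra F₀ K]
variable (I : ThetaVolumeInput F₀ K)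

/-- **Every hull-volume estimate of a genuine Θ-volume input dominates the good-share mass at every support prime**:
`I.HullEstimateOf δ → (Σ_{v|p, v∉S} Pr(v))·((ℓ⋇+1)(2ℓ⋇+1)/6)·Σ_{v|p} μ(v)Pr(v) ≤ δ` for `p ∈ T(I)` (abc-iut-S8's
`slotResidue_le_of_hullEstimateOf` ∘ `goodWeight_mul_closed_le_slotResidue`).
[cite: Mochizuki2012, IUTchIV Thm. 1.10 Step (v) p. 27–28] [cite: DupuyHilado2025, §4.7, §4.12] -/
theorem goodWeight_mul_le_of_hullEstimateOf {δ : ℝ} (h : I.HullEstimateOf δ) {p : ℕ} [Fact p.Prime]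
    (hp : p ∈ I.supportPrimes) :
    (∑ v ∈ Finset.univ.filter (fun v : placesOver F₀ p => v.1 ∉ I.X.S), weight F₀ v.1) *
        ((((I.X.lstar : ℝ) + 1) * (2 * I.X.lstar + 1) / 6) *
          ∑ v : placesOver F₀ p, (I.X.qPilot v.1 * logNorm F₀ v.1 / (localDegree F₀ v.1 : ℝ)) * weight F₀ v.1) ≤
      δ :=
  (I.X.goodWeight_mul_closed_le_slotResidue I.supportPrimes hp).trans (slotResidue_le_of_hullEstimateOf I h)

end Input

end DHData

namespace PointDict

variable {P : NFPoint} {l : ℕ}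

/-- **At the `λ`-line, per datum**: `T.HullEstimateOf δ` forces, at every support prime `p` of the datum's input,
`(1 − β_p(T))·(l(l+1)/12)·Σ_{v|p} μ_T(v)Pr(v) ≤ δ` over `F_mod` (`μ_T` as in abc-iut-S7's `mu_eq`; procession factor
`(ℓ⋇+1)(2ℓ⋇+1)/6 = l(l+1)/12` by `avgSq_eq`). [cite: Mochizuki2012, IUTchIV Thm. 1.10 Step (v) p. 27–28] -/
theorem goodWeight_mul_le_of_hullEstimateOf (T : Cor22.ThetaVolumeDatumAt P l) {δ : ℝ} (h : T.HullEstimateOf δ) :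
    (letI := T.instFieldF; letI := T.instNumberFieldF; letI := T.instAlgebraF; letI := T.instFieldK
     letI := T.instNumberFieldK; letI := T.instAlgebraK; letI := T.instFieldFbar; letI := T.instAlgebraFbar
     letI := T.instAlgebraKFbar; letI := T.instIsElliptic
     ∀ (p : ℕ) [Fact p.Prime], p ∈ T.I.supportPrimes →
       (∑ v ∈ Finset.univ.filter (fun v : placesOver (fieldOfModuli T.E) p => v.1 ∉ T.I.X.S),
           weight (fieldOfModuli T.E) v.1) *
         (((l : ℝ) * ((l : ℝ) + 1) / 12) *
           ∑ v : placesOver (fieldOfModuli T.E) p,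
             (T.I.X.qPilot v.1 * logNorm (fieldOfModuli T.E) v.1 / (localDegree (fieldOfModuli T.E) v.1 : ℝ)) *
               weight (fieldOfModuli T.E) v.1) ≤ δ) := by
  letI := T.instFieldF; letI := T.instNumberFieldF; letI := T.instAlgebraF; letI := T.instFieldK
  letI := T.instNumberFieldK; letI := T.instAlgebraK; letI := T.instFieldFbar; letI := T.instAlgebraFbar
  letI := T.instAlgebraKFbar; letI := T.instIsElliptic
  intro p _ hp
  have h1 := DHData.goodWeight_mul_le_of_hullEstimateOf T.I h hp
  rw [avgSq_eq T] at h1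
  exact h1

/-- **`Cor22.HullVolumeAtDatum P l δ` bounds the good-share `q`-mass of EVERY genuine datum at `(P, l)`**: for every
`T : Cor22.ThetaVolumeDatumAt P l` and every support prime `p`, `(1 − β_p(T))·(l(l+1)/12)·Σ_{v|p} μ_T(v)Pr(v) ≤ δ`.
With `δ = B(P,l)` this is what the `hvol` binder of `Conditional/AbcOfS*.lean` (child (ii′) of stmt-ABC-19678 on the
UNION line) asserts about the POINT beyond print: the part of `((l+1)/24)·log(q)` sitting at primes of `F_mod` split
into bad and good places is bounded by `B(P,l)`; vacuous when every support prime is totally bad or totally good over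
`F_mod` (e.g. `d_mod = 1`). Nothing asserted about the existence of data. [claim: Mochizuki2012, status: disputed] -/
theorem goodWeight_mul_le_of_hullVolumeAtDatum {δ : ℝ} (h : Cor22.HullVolumeAtDatum P l δ)
    (T : Cor22.ThetaVolumeDatumAt P l) :
    (letI := T.instFieldF; letI := T.instNumberFieldF; letI := T.instAlgebraF; letI := T.instFieldK
     letI := T.instNumberFieldK; letI := T.instAlgebraK; letI := T.instFieldFbar; letI := T.instAlgebraFbar
     letI := T.instAlgebraKFbar; letI := T.instIsElliptic
     ∀ (p : ℕ) [Fact p.Prime], p ∈ T.I.supportPrimes →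
       (∑ v ∈ Finset.univ.filter (fun v : placesOver (fieldOfModuli T.E) p => v.1 ∉ T.I.X.S),
           weight (fieldOfModuli T.E) v.1) *
         (((l : ℝ) * ((l : ℝ) + 1) / 12) *
           ∑ v : placesOver (fieldOfModuli T.E) p,
             (T.I.X.qPilot v.1 * logNorm (fieldOfModuli T.E) v.1 / (localDegree (fieldOfModuli T.E) v.1 : ℝ)) *
               weight (fieldOfModuli T.E) v.1) ≤ δ) :=
  goodWeight_mul_le_of_hullEstimateOf T (h T)

end PointDict

end Summit.ABC.IUTFork

end
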